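/-
Copyright (c) 2026 the pub-hodgecm-mathlib formalisation cell (harness21).  Prover seat hodgecm-mathlib-K2E3-p32 (g0), HCML Track B «K2-LIT» (close-out strike line L4
`stub_StCharTS`), h413 = `stmt-HodgeConjecture-24833`, line `K2_E3_EllipticInputs`, PART «SC» socket (SC-an)₂ `sig_K2E3SupercuspidalTruncatedCharAnalyticTwo`, the (M5h₂)
chain (dealer K2E3-plan (g4) EMIT #1 2026-09-04T14:52:25Z, deal D137): [M1]₂, the `U(1,1)` twin of ★ [M1] `K2E3SupercuspOrbitalSliceCuspidalModel` (K2E3-p20 (g3)) —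
THE ORBITAL SLICE OF A SUPERCUSPIDAL COEFFICIENT OF `U(σ, Φ₂)(K)` IS A HARISH-CHANDRA CUSP FORM.  2026-09-04.
-/
import Summits.HodgeConjecture.HodgeConjecture.Theorems.K2E3SupercuspOrbitalSliceCuspidalModel     -- ★ [M1] (K2E3-p20 (g3)) §1 ABSTRACT `exists_isHaarMeasure_integral_map_conj_eq`; brings ★ `K2E1SupercuspidalCoefficientNCuspidal`, ★ `F0P3cStCharTSWeylHypFibre`, ★ `RegularDiagonalCentralizer`, ★ `isMulRightInvariant_of_iUnion_isCompact_subgroup`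
import Summits.HodgeConjecture.HodgeConjecture.Theorems.K2E3UnipotentConjTwistBochnerTwo        -- ★∕📤 (this seat) [B1]: Lemma 22 Bochner form on `U(σ, Φ₂)(R)` and the `w`-twin (rank-one line twist)
import Summits.HodgeConjecture.HodgeConjecture.Theorems.K2E1UnipotentExhaustionU2                -- ★ `exists_compactOpen_subgroups_exhausting_unipotentU_two`; brings ★ `K2E1SupercuspidalJacquetVanishingU2.coinvariants_subsingleton_of_isSupercuspidal_two`
import Summits.HodgeConjecture.HodgeConjecture.Theorems.F0P3cIwahoriDatumU2Alg                   -- ★ any rank: `weylLongU_inv_eq`, `coe_weylConj_of_eq_glDiagonal`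
import Literature.NumberTheory.Automorphic.U3SupercuspFormUnipotentIntegral                        -- ★ GENERIC §1–§2: `integral_dual_apply_eq_zero_of_mem_span_of_exhaustion` (Jacquet's first lemma against an exhaustion)
import HarnessLib

/-!
# K2_E3 road (h413), socket (SC-an)₂, [M1]₂: THE ORBITAL SLICE OF A SUPERCUSPIDAL COEFFICIENT OF `U(σ, Φ₂)(K)` IS A HARISH-CHANDRA CUSP FORM —
# `Fin 2` twin of ★ [M1] `K2E3SupercuspOrbitalSliceCuspidalModel` (cuspidality along the line `N₂` and along `N̄₂ = w₀N₂w₀⁻¹`, each for EVERY Haar measure)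

Cell `pub/hodgecm-mathlib`, Track B «K2-LIT», crux H413 = `stmt-HodgeConjecture-24833` (`--supports … --as helper`, count-neutral); chair K2-lead (g2), LINE-LEAD∕dealer
K2E3-plan (g4), architect K2E3-p25 (g3).  THEOREMS ONLY (no `def`, no `instance`, no `notation`, no named-fact hypothesis, no `sorry`).

THE PORT.  The Theorem-20 machinery of the (SC-an)₂ line (★ `K2E3CuspFormCancellationU2Torus` ∕ `InputsAnyRank` ∕ `U2Inputs` ∕ `U2LevelOne`, this seat, over the rank-free
★ `K2E3CuspFormCancellationCore` ∕ `Heights` ∕ `LevelOne`) lives on the one-place FIELD model `U(σ, Φ₂)(K)`; its cusp form `f` enters through `hcusp : ∀ x, ∫ n : ↥N, f (x * ↑n) ∂ν = 0`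
(Haar `ν` on `↥N`) and the same along `N̄` with its own Haar `ν̄`.  This file supplies both for `f = f_t`, `t = diag d` REGULAR, `θ = B u' (ρ(·) u)` a coefficient of a smooth
SUPERCUSPIDAL `ρ` — ★ [M1] (K2E3-p20 (g3)) with `Φ₃ ↦ Φ₂`, TOKEN FOR TOKEN except: (a) the Heisenberg regular twist (two root values, `σ` an involution, `2 ≠ 0`) becomes the
rank-one LINE twist of ★ `K2E3UnipotentConjTwistBochnerTwo` (one root value `d₀⁻¹d₁`; the hypotheses `hσ`, `h2` DISAPPEAR); (b) the `Φ₃`-only Literature head ★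
`integral_dual_apply_unipotentU_eq_zero_of_isSupercuspidal` is replaced by its `Φ₂` twin `integral_dual_apply_unipotentU_two_eq_zero_of_isSupercuspidal` (§2 here, the same
proof over ★ `K2E1SupercuspidalJacquetVanishingU2.coinvariants_subsingleton_of_isSupercuspidal_two` and ★ `K2E1UnipotentExhaustionU2.exists_compactOpen_subgroups_exhausting_unipotentU_two`);
(c) `w₀² = 1` and `w₀ diag(d) w₀ = diag(d ∘ rev)` come from the any-rank ★ `F0P3cIwahoriDatumU2`.  Hypotheses: `σ` continuous, scalar (`hZs`) and compact (`hZc`) centre, a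
`σ`-fixed `ϖ` with `0 < |ϖ| < 1` — all ★ at `K = L_w`.
* §1 = ★ [M1] §1 `exists_isHaarMeasure_integral_map_conj_eq` (abstract `G`; imported, not repeated).
* §2 `integral_dual_apply_unipotentU_two_eq_zero_of_isSupercuspidal` (the `Φ₂` head: `∫_N φ(ρ(a n b) w) dμ = 0` for `μ` right-invariant finite on compacta, integrable
  coefficient); `integral_coeff_translate_unipotentU_eq_zero_of_isSupercuspidal` — two-sided `N`-cuspidality `∫_N B u' (ρ(a n b) u) dν = 0` for EVERY Haar `ν`;
  **`integral_coeff_conj_unipotentU_eq_zero_of_isSupercuspidal`** (`∫_N θ(a · n t n⁻¹ · b) dν = 0`); `integral_coeff_slice_unipotentU_eq_zero_of_isSupercuspidal`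
  (`∫_N f_t(x n) dν = 0`); **`integral_coeff_slice_unipotentU_map_conj_weylLongU_eq_zero_of_isSupercuspidal`** (`∫_{N̄} f_t(x n̄) dν̄ = 0`); `continuous_coeff_conj`,
  `coeff_conj_mul_eq_of_mem_torusU`.

HONEST LABEL: HC_CM is proved only modulo the 7 printed citations (2 remaining named inputs: hLiu418 = stmt-HodgeConjecture-24832, h413 = stmt-HodgeConjecture-24833) until
rung 0 closes; this file is a count-neutral helper; (SC-an)₂ is NOT ★ until COLL₂ + NC₂ + the whole (M5h₂) chain land.

## References
* [HarishChandra1970] Harish-Chandra (notes by G. van Dijk), *Harmonic Analysis on Reductive p-adic Groups*, LNM 162 (1970), Part I §3 p. 9; Part V §6 Lemma 22 p. 42;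
  Part VII §2 Theorem 20 p. 70 (i)(ii).
* [Rogawski1990] J. D. Rogawski, *Automorphic Representations of Unitary Groups in Three Variables*, Ann. of Math. Stud. 123 (1990), §1.9–§1.10 pp. 8–9, §3.1 p. 19, §4.9 p. 55,
  §12.2 p. 173.
* [Casselman1995] W. Casselman, *Introduction to the theory of admissible representations of p-adic reductive groups* (1995), Prop. 1.4.4, Thm. 5.3.1.
* [Folland1995] G. B. Folland, *A Course in Abstract Harmonic Analysis* (1995), §2.4.
-/

set_option autoImplicit false
-- the mandated namespace repeats the single-problem summit's segment (`HodgeConjecture.HodgeConjecture`)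
set_option linter.dupNamespace false

noncomputable section

open MeasureTheory Measure Set Filter Topology
open scoped NNReal ENNReal Pointwise Matrix MatrixGroups

namespace Summit.HodgeConjecture.HodgeConjecture.Cruxes.H413.K2E3SupercuspOrbitalSliceCuspidalModelTwo

open K2E3UnipotentConjTwistBochner

/-! ## §2 The field model `U(σ, Φ₂)(K)` over a non-archimedean local field: the slice of a supercuspidal coefficient is a cusp form -/

section Model

open ValuativeRel
open Literature.NumberTheory.Automorphic Literature.NumberTheory.Automorphic.UnitaryGroup
  Literature.NumberTheory.Automorphic.UnitaryGroup.HeisRing Literature.NumberTheory.Rogawski1990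

variable {K : Type*} [Field K] [ValuativeRel K] [TopologicalSpace K] [IsNonarchimedeanLocalField K]

/-- **MATRIX COEFFICIENTS OF SUPERCUSPIDAL REPRESENTATIONS OF THE QUASI-SPLIT `U(1,1) = U(σ, Φ₂)(K)` ARE SUPERCUSP FORMS** (the `Φ₂` twin of ★
`UnitaryGroup.integral_dual_apply_unipotentU_eq_zero_of_isSupercuspidal`, same proof): `σ` continuous, SCALAR centre, `ϖ ≠ 0` `σ`-fixed with `|ϖ| < 1`, `N = unipotentU` with a
right-invariant Borel measure `μ` finite on compacta; for every SMOOTH SUPERCUSPIDAL `ρ`, linear form `φ`, vector `w`, `a, b ∈ U`: if `n ↦ φ(ρ(a n b) w)` is integrable on `N`, then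
`∫_N φ(ρ(a n b) w) dμ(n) = 0` — `V = V(N)` (★ `coinvariants_subsingleton_of_isSupercuspidal_two`) and Jacquet's first lemma against the exhaustion ★
`exists_compactOpen_subgroups_exhausting_unipotentU_two` (★ generic `integral_dual_apply_eq_zero_of_mem_span_of_exhaustion`).
[cite: HarishChandra1970, Part I §3] [cite: Casselman1995, Thm. 5.3.1] [cite: Rogawski1990, §12.2 p. 173] -/
theorem integral_dual_apply_unipotentU_two_eq_zero_of_isSupercuspidal (σ : K →+* K) (hσc : Continuous σ)
    {J : Matrix (Fin 2) (Fin 2) K} (hJ : J = (StdForm.antidiagonal 2).over K)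
    (hZ : ∀ z ∈ Subgroup.center ↥(unitaryGroupOfForm σ J), ∃ u : Kˣ,
      ((z : ↥(unitaryGroupOfForm σ J)) : GL (Fin 2) K) = Matrix.GeneralLinearGroup.scalar (Fin 2) u)
    {ϖ : K} (hϖ0 : ϖ ≠ 0) (hϖ1 : valuation K ϖ < 1) (hσϖ : σ ϖ = ϖ)
    {V : Type*} [AddCommGroup V] [Module ℂ V]
    (ρ : Representation ℂ ↥(unitaryGroupOfForm σ J) V) (hρ : ρ.IsSmooth) (hsc : ρ.IsSupercuspidal)
    [MeasurableSpace ↥(unipotentU σ J)] [BorelSpace ↥(unipotentU σ J)]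
    (μ : Measure ↥(unipotentU σ J)) [IsFiniteMeasureOnCompacts μ] [μ.IsMulRightInvariant]
    (φ : Module.Dual ℂ V) (w : V) (a b : ↥(unitaryGroupOfForm σ J))
    (hi : Integrable (fun n : ↥(unipotentU σ J) => φ (ρ (a * n * b) w)) μ) :
    ∫ n : ↥(unipotentU σ J), φ (ρ (a * n * b) w) ∂μ = 0 := by
  haveI : T2Space K := (Literature.NumberTheory.GaloisRepresentations.IsNonarchimedeanLocalField.isLocalField K).toT2Space
  -- `V = V(N)`: the Jacquet module along the Borel vanishes
  haveI hsub := K2E1SupercuspidalJacquetVanishingU2.coinvariants_subsingleton_of_isSupercuspidal_two σ hJ hσc hZ hϖ0 hϖ1 hσϖ ρ hρ hsc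
  have hker : ρ b w ∈ Submodule.span ℂ (Set.range fun p : ↥(unipotentU σ J) × V => ρ (p.1 : ↥(unitaryGroupOfForm σ J)) p.2 - p.2) := by
    have h0 : Representation.Coinvariants.mk ((borelTriple σ J hJ).restrict ρ) (ρ b w) = 0 := Subsingleton.elim _ _
    rw [Representation.Coinvariants.mk_eq_zero] at h0
    -- the generators of `ker (restrict ρ)` are among ours
    refine (Submodule.span_le.2 ?_) h0
    rintro _ ⟨⟨q, x⟩, rfl⟩
    refine Submodule.subset_span ⟨(⟨((q : ↥(borelTriple σ J hJ).P) : ↥(unitaryGroupOfForm σ J)), Subgroup.mem_subgroupOf.1 q.2⟩, x), ?_⟩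
    rfl
  obtain ⟨Nj, hmono, hc, ho, hex⟩ := K2E1UnipotentExhaustionU2.exists_compactOpen_subgroups_exhausting_unipotentU_two σ hJ hσc hϖ0 hϖ1 hσϖ
  have e1 : ∀ n : ↥(unipotentU σ J), φ (ρ (a * n * b) w) = φ (ρ (a * n) (ρ b w)) := fun n => by
    rw [map_mul, Module.End.mul_apply]
  simp_rw [e1] at hi ⊢
  exact integral_dual_apply_eq_zero_of_mem_span_of_exhaustion ρ (unipotentU σ J) μ hρ hker Nj hmono hc ho hex φ a hi

set_option synthInstance.maxHeartbeats 400000 in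
set_option maxHeartbeats 1600000 in
-- instance-term unification on the model carriers
/-- **SUPERCUSPIDAL COEFFICIENTS OF `U(σ, Φ₂)(K)` ARE TWO-SIDEDLY `N`-CUSPIDAL FOR EVERY HAAR MEASURE OF `N(K)`.**  `σ` continuous, `J = Φ₃`, centre SCALAR
(`hZs`) and COMPACT (`hZc`), `ϖ ≠ 0` `σ`-fixed with `|ϖ| < 1`; `ρ` smooth supercuspidal with a `U`-invariant sesquilinear form `B`; `ν` ANY Haar measure on
`↥(unipotentU σ J)`.  Then `∫_N B u' (ρ(a n b) u) dν(n) = 0` (§2 `integral_dual_apply_unipotentU_two_eq_zero_of_isSupercuspidal`, the `Φ₂` twin of ★ `integral_dual_apply_unipotentU_eq_zero_of_isSupercuspidal`; right-invariance of `ν` by ★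
`isMulRightInvariant_of_iUnion_isCompact_subgroup` ∘ ★ `K2E1UnipotentExhaustionU2.exists_compactOpen_subgroups_exhausting_unipotentU_two`; integrability ★
`integrable_sesqForm_apply_translate_restrict`). [cite: HarishChandra1970, Part I §3 p. 9] [cite: Casselman1995, Thm. 5.3.1] [cite: Rogawski1990, §12.2 p. 173] -/
theorem integral_coeff_translate_unipotentU_eq_zero_of_isSupercuspidal [SecondCountableTopology (GL (Fin 2) K)]
    (σ : K →+* K) (hσc : Continuous σ) {J : Matrix (Fin 2) (Fin 2) K} (hJ : J = (StdForm.antidiagonal 2).over K)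
    (hZs : ∀ z ∈ Subgroup.center ↥(unitaryGroupOfForm σ J), ∃ u : Kˣ,
      ((z : ↥(unitaryGroupOfForm σ J)) : GL (Fin 2) K) = Matrix.GeneralLinearGroup.scalar (Fin 2) u)
    (hZc : IsCompact ((Subgroup.center ↥(unitaryGroupOfForm σ J) : Subgroup ↥(unitaryGroupOfForm σ J)) : Set ↥(unitaryGroupOfForm σ J)))
    {ϖ : K} (hϖ0 : ϖ ≠ 0) (hϖ1 : valuation K ϖ < 1) (hσϖ : σ ϖ = ϖ)
    {V : Type*} [AddCommGroup V] [Module ℂ V] (ρ : Representation ℂ ↥(unitaryGroupOfForm σ J) V) (hsm : ρ.IsSmooth) (hsc : ρ.IsSupercuspidal)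
    (B : V →ₗ⋆[ℂ] V →ₗ[ℂ] ℂ) (hBinv : ∀ (g : ↥(unitaryGroupOfForm σ J)) (x y : V), B (ρ g x) (ρ g y) = B x y)
    [MeasurableSpace ↥(unipotentU σ J)] [BorelSpace ↥(unipotentU σ J)] (ν : Measure ↥(unipotentU σ J)) [IsHaarMeasure ν]
    (a b : ↥(unitaryGroupOfForm σ J)) (u u' : V) :
    ∫ n, B u' (ρ (a * (n : ↥(unitaryGroupOfForm σ J)) * b) u) ∂ν = 0 := by
  haveI : T2Space K := (Literature.NumberTheory.GaloisRepresentations.IsNonarchimedeanLocalField.isLocalField K).toT2Space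
  haveI : SecondCountableTopology ↥(unitaryGroupOfForm σ J) := TopologicalSpace.Subtype.secondCountableTopology _
  haveI : SecondCountableTopology ↥(unipotentU σ J) := TopologicalSpace.Subtype.secondCountableTopology _
  obtain ⟨Nj, -, hc, ho, hex⟩ := K2E1UnipotentExhaustionU2.exists_compactOpen_subgroups_exhausting_unipotentU_two σ hJ hσc hϖ0 hϖ1 hσϖ
  haveI : WeaklyLocallyCompactSpace ↥(unipotentU σ J) :=
    ⟨fun n => by obtain ⟨j, hj⟩ := hex n; exact ⟨_, hc j, (ho j).mem_nhds hj⟩⟩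
  haveI : ν.IsMulRightInvariant := Literature.MeasureTheory.Group.isMulRightInvariant_of_iUnion_isCompact_subgroup ν Nj hc hex
  have hN : IsClosed ((unipotentU σ J : Subgroup ↥(unitaryGroupOfForm σ J)) : Set ↥(unitaryGroupOfForm σ J)) :=
    (isClosed_upperUnitriangular (n := 2) (R := K)).preimage continuous_subtype_val
  exact integral_dual_apply_unipotentU_two_eq_zero_of_isSupercuspidal σ hσc hJ hZs hϖ0 hϖ1 hσϖ ρ hsm hsc ν (B u') u a b
    (K2E1SupercuspidalCoefficientNCuspidal.integrable_sesqForm_apply_translate_restrict ρ (unipotentU σ J) ν hsc hZc hsm hBinv hN a b u u')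

set_option synthInstance.maxHeartbeats 400000 in
set_option maxHeartbeats 1600000 in
-- instance-term unification on the model carriers
/-- **THE HEAD AT THE MODEL — `∫_N θ(a · n t n⁻¹ · b) dν = 0`** for `θ = B u' (ρ(·) u)` a supercuspidal coefficient of `U(σ, Φ₂)(K)` (`σ` continuous, `K` second countable) and `t = diag d` REGULAR (★ `isUnit_sub_of_isRegularElt_glDiagonal`): Lemma 22 on the line `N₂` (★ `K2E3UnipotentConjTwistBochnerTwo`, this seat) ∘ the cusp condition.
[cite: HarishChandra1970, Part V §6 Lemma 22 p. 42; Part VII §2 p. 70 (ii)] [cite: Rogawski1990, §4.9 p. 54] -/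
theorem integral_coeff_conj_unipotentU_eq_zero_of_isSupercuspidal [SecondCountableTopology K] [SecondCountableTopology (GL (Fin 2) K)]
    [MeasurableSpace K] [BorelSpace K]
    (σ : K →+* K) (hσc : Continuous σ)
    {J : Matrix (Fin 2) (Fin 2) K} (hJ : J = (StdForm.antidiagonal 2).over K)
    (hZs : ∀ z ∈ Subgroup.center ↥(unitaryGroupOfForm σ J), ∃ u : Kˣ,
      ((z : ↥(unitaryGroupOfForm σ J)) : GL (Fin 2) K) = Matrix.GeneralLinearGroup.scalar (Fin 2) u)
    (hZc : IsCompact ((Subgroup.center ↥(unitaryGroupOfForm σ J) : Subgroup ↥(unitaryGroupOfForm σ J)) : Set ↥(unitaryGroupOfForm σ J)))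
    {ϖ : K} (hϖ0 : ϖ ≠ 0) (hϖ1 : valuation K ϖ < 1) (hσϖ : σ ϖ = ϖ)
    {V : Type*} [AddCommGroup V] [Module ℂ V] (ρ : Representation ℂ ↥(unitaryGroupOfForm σ J) V) (hsm : ρ.IsSmooth) (hsc : ρ.IsSupercuspidal)
    (B : V →ₗ⋆[ℂ] V →ₗ[ℂ] ℂ) (hBinv : ∀ (g : ↥(unitaryGroupOfForm σ J)) (x y : V), B (ρ g x) (ρ g y) = B x y)
    [MeasurableSpace ↥(unipotentU σ J)] [BorelSpace ↥(unipotentU σ J)] (ν : Measure ↥(unipotentU σ J)) [IsHaarMeasure ν]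
    (t : ↥(unitaryGroupOfForm σ J)) {d : Fin 2 → Kˣ} (hd : glDiagonal 2 K d = (t : GL (Fin 2) K)) (hreg : IsRegularElt (t : GL (Fin 2) K))
    (a b : ↥(unitaryGroupOfForm σ J)) (u u' : V) :
    ∫ n, B u' (ρ (a * ((n : ↥(unitaryGroupOfForm σ J)) * t * (n : ↥(unitaryGroupOfForm σ J))⁻¹) * b) u) ∂ν = 0 := by
  haveI : T2Space K := (Literature.NumberTheory.GaloisRepresentations.IsNonarchimedeanLocalField.isLocalField K).toT2Space
  have hreg' : IsRegularElt (glDiagonal 2 K d) := by rw [hd]; exact hreg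
  have hb : IsUnit ((((d 0)⁻¹ * d 1 : Kˣ) : K) - 1) :=
    isUnit_coe_inv_mul_sub_one (F0P3cStCharTSWeylHypFibre.isUnit_sub_of_isRegularElt_glDiagonal hreg' (by decide))
  have ht : t ∈ torusU σ J := (mem_torusU_iff t).2 ⟨d, hd⟩
  exact K2E3UnipotentConjTwistBochnerTwo.integral_conj_unipotentU_eq_zero_of_forall_integral_eq_zero_two σ hσc hJ ν ht hd hb (fun g => B u' (ρ g u))
    (fun a' b' => integral_coeff_translate_unipotentU_eq_zero_of_isSupercuspidal σ hσc hJ hZs hZc hϖ0 hϖ1 hσϖ ρ hsm hsc B hBinv ν a' b' u u')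
    (fun a' b' => (K2E1SupercuspidalCoefficientNCuspidal.continuous_sesqForm_apply_translate_restrict ρ (unipotentU σ J) (B := B) hsm a' b' u u').aestronglyMeasurable)
    a b

set_option synthInstance.maxHeartbeats 400000 in
set_option maxHeartbeats 1600000 in
-- instance-term unification on the model carriers
/-- **(Φ_C (ii) along `N`)** `∫_N f_t(x n) dν = 0` for every `x` and every Haar `ν` on `N(K)` (the head at `(x, x⁻¹)`) — the hypothesis `hcusp` of ★
`K2E3CuspFormCancellationCore` for `f = f_t`. [cite: HarishChandra1970, Part VII §2 p. 70 (ii)] -/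
theorem integral_coeff_slice_unipotentU_eq_zero_of_isSupercuspidal [SecondCountableTopology K] [SecondCountableTopology (GL (Fin 2) K)]
    [MeasurableSpace K] [BorelSpace K]
    (σ : K →+* K) (hσc : Continuous σ)
    {J : Matrix (Fin 2) (Fin 2) K} (hJ : J = (StdForm.antidiagonal 2).over K)
    (hZs : ∀ z ∈ Subgroup.center ↥(unitaryGroupOfForm σ J), ∃ u : Kˣ,
      ((z : ↥(unitaryGroupOfForm σ J)) : GL (Fin 2) K) = Matrix.GeneralLinearGroup.scalar (Fin 2) u)
    (hZc : IsCompact ((Subgroup.center ↥(unitaryGroupOfForm σ J) : Subgroup ↥(unitaryGroupOfForm σ J)) : Set ↥(unitaryGroupOfForm σ J)))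
    {ϖ : K} (hϖ0 : ϖ ≠ 0) (hϖ1 : valuation K ϖ < 1) (hσϖ : σ ϖ = ϖ)
    {V : Type*} [AddCommGroup V] [Module ℂ V] (ρ : Representation ℂ ↥(unitaryGroupOfForm σ J) V) (hsm : ρ.IsSmooth) (hsc : ρ.IsSupercuspidal)
    (B : V →ₗ⋆[ℂ] V →ₗ[ℂ] ℂ) (hBinv : ∀ (g : ↥(unitaryGroupOfForm σ J)) (x y : V), B (ρ g x) (ρ g y) = B x y)
    [MeasurableSpace ↥(unipotentU σ J)] [BorelSpace ↥(unipotentU σ J)] (ν : Measure ↥(unipotentU σ J)) [IsHaarMeasure ν]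
    (t : ↥(unitaryGroupOfForm σ J)) {d : Fin 2 → Kˣ} (hd : glDiagonal 2 K d = (t : GL (Fin 2) K)) (hreg : IsRegularElt (t : GL (Fin 2) K))
    (u u' : V) (x : ↥(unitaryGroupOfForm σ J)) :
    ∫ n, B u' (ρ (x * (n : ↥(unitaryGroupOfForm σ J)) * t * (x * (n : ↥(unitaryGroupOfForm σ J)))⁻¹) u) ∂ν = 0 := by
  have h := integral_coeff_conj_unipotentU_eq_zero_of_isSupercuspidal σ hσc hJ hZs hZc hϖ0 hϖ1 hσϖ ρ hsm hsc B hBinv ν t hd hreg x x⁻¹ u u'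
  have heq : (fun n : ↥(unipotentU σ J) => B u' (ρ (x * (n : ↥(unitaryGroupOfForm σ J)) * t * (x * (n : ↥(unitaryGroupOfForm σ J)))⁻¹) u)) =
      fun n : ↥(unipotentU σ J) => B u' (ρ (x * ((n : ↥(unitaryGroupOfForm σ J)) * t * (n : ↥(unitaryGroupOfForm σ J))⁻¹) * x⁻¹) u) := by
    funext n; congr 2; group
  rw [heq]; exact h

set_option synthInstance.maxHeartbeats 400000 in
set_option maxHeartbeats 1600000 in
-- instance-term unification on the model carriers
/-- **(Φ_C (ii) along `N̄ = w₀Nw₀⁻¹`)** `∫_{N̄} f_t(x n̄) dν̄ = 0` for every `x` and every Haar `ν̄` on `↥(N.map (conj w₀))` (★ [M1] §1 + the `w`-twin of ★ `K2E3UnipotentConjTwistBochnerTwo`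
at `t' = w₀ t w₀ = diag(d ∘ rev)`, ★ any-rank `F0P3cIwahoriDatumU2.coe_weylConj_of_eq_glDiagonal`, `w₀⁻¹ = w₀`) — the second `hcusp` of ★ `K2E3CuspFormCancellationCore` for `f = f_t`.
[cite: HarishChandra1970, Part VII §2 p. 70 (ii)] [cite: Rogawski1990, §1.10 p. 9] -/
theorem integral_coeff_slice_unipotentU_map_conj_weylLongU_eq_zero_of_isSupercuspidal [SecondCountableTopology K]
    [SecondCountableTopology (GL (Fin 2) K)] [MeasurableSpace K] [BorelSpace K]
    (σ : K →+* K) (hσc : Continuous σ)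
    {J : Matrix (Fin 2) (Fin 2) K} (hJ : J = (StdForm.antidiagonal 2).over K)
    (hZs : ∀ z ∈ Subgroup.center ↥(unitaryGroupOfForm σ J), ∃ u : Kˣ,
      ((z : ↥(unitaryGroupOfForm σ J)) : GL (Fin 2) K) = Matrix.GeneralLinearGroup.scalar (Fin 2) u)
    (hZc : IsCompact ((Subgroup.center ↥(unitaryGroupOfForm σ J) : Subgroup ↥(unitaryGroupOfForm σ J)) : Set ↥(unitaryGroupOfForm σ J)))
    {ϖ : K} (hϖ0 : ϖ ≠ 0) (hϖ1 : valuation K ϖ < 1) (hσϖ : σ ϖ = ϖ)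
    {V : Type*} [AddCommGroup V] [Module ℂ V] (ρ : Representation ℂ ↥(unitaryGroupOfForm σ J) V) (hsm : ρ.IsSmooth) (hsc : ρ.IsSupercuspidal)
    (B : V →ₗ⋆[ℂ] V →ₗ[ℂ] ℂ) (hBinv : ∀ (g : ↥(unitaryGroupOfForm σ J)) (x y : V), B (ρ g x) (ρ g y) = B x y)
    [MeasurableSpace ↥(unipotentU σ J)] [BorelSpace ↥(unipotentU σ J)]
    [MeasurableSpace ↥((unipotentU σ J).map (MulAut.conj (weylLongU σ hJ)).toMonoidHom)]
    [BorelSpace ↥((unipotentU σ J).map (MulAut.conj (weylLongU σ hJ)).toMonoidHom)]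
    (ν' : Measure ↥((unipotentU σ J).map (MulAut.conj (weylLongU σ hJ)).toMonoidHom)) [IsHaarMeasure ν']
    (t : ↥(unitaryGroupOfForm σ J)) {d : Fin 2 → Kˣ} (hd : glDiagonal 2 K d = (t : GL (Fin 2) K)) (hreg : IsRegularElt (t : GL (Fin 2) K))
    (u u' : V) (x : ↥(unitaryGroupOfForm σ J)) :
    ∫ m, B u' (ρ (x * (m : ↥(unitaryGroupOfForm σ J)) * t * (x * (m : ↥(unitaryGroupOfForm σ J)))⁻¹) u) ∂ν' = 0 := by
  haveI : T2Space K := (Literature.NumberTheory.GaloisRepresentations.IsNonarchimedeanLocalField.isLocalField K).toT2Space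
  obtain ⟨ν, hν, hF⟩ := K2E3SupercuspOrbitalSliceCuspidalModel.exists_isHaarMeasure_integral_map_conj_eq (unipotentU σ J) (weylLongU σ hJ) ν' (E := ℂ)
  haveI : IsHaarMeasure ν := hν
  rw [hF (fun g => B u' (ρ (x * g * t * (x * g)⁻¹) u))]
  -- `t' = w₀ t w₀ = diag (d ∘ rev)` is regular diagonal, and `w₀⁻¹ t w₀ = t'`
  have hreg' : IsRegularElt (glDiagonal 2 K d) := by rw [hd]; exact hreg
  have hw0 : (weylLongU σ hJ)⁻¹ = weylLongU σ hJ := F0P3cIwahoriDatumU2.weylLongU_inv_eq σ hJ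
  have hd' : glDiagonal 2 K (d ∘ Fin.rev) = ((weylLongU σ hJ * t * weylLongU σ hJ : ↥(unitaryGroupOfForm σ J)) : GL (Fin 2) K) :=
    (F0P3cIwahoriDatumU2.coe_weylConj_of_eq_glDiagonal σ hJ hd.symm).symm
  have ht' : weylLongU σ hJ * t * weylLongU σ hJ ∈ torusU σ J := (mem_torusU_iff _).2 ⟨d ∘ Fin.rev, hd'⟩
  have hw : (weylLongU σ hJ)⁻¹ * t * weylLongU σ hJ = weylLongU σ hJ * t * weylLongU σ hJ := by rw [hw0]
  have hb' : IsUnit (((((d ∘ Fin.rev) 0)⁻¹ * (d ∘ Fin.rev) 1 : Kˣ) : K) - 1) :=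
    isUnit_coe_inv_mul_sub_one (F0P3cStCharTSWeylHypFibre.isUnit_sub_of_isRegularElt_glDiagonal hreg' (by decide))
  have h := K2E3UnipotentConjTwistBochnerTwo.integral_conj_conj_unipotentU_eq_zero_of_forall_integral_eq_zero_two σ hσc hJ ν t (weylLongU σ hJ)
    ht' hw hd' hb' (fun g => B u' (ρ g u))
    (fun a' b' => integral_coeff_translate_unipotentU_eq_zero_of_isSupercuspidal σ hσc hJ hZs hZc hϖ0 hϖ1 hσϖ ρ hsm hsc B hBinv ν a' b' u u')
    (fun a' b' => (K2E1SupercuspidalCoefficientNCuspidal.continuous_sesqForm_apply_translate_restrict ρ (unipotentU σ J) (B := B) hsm a' b' u u').aestronglyMeasurable)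
    x x⁻¹
  have heq : (fun n : ↥(unipotentU σ J) => B u' (ρ (x * (weylLongU σ hJ * (n : ↥(unitaryGroupOfForm σ J)) * (weylLongU σ hJ)⁻¹) * t *
      (x * (weylLongU σ hJ * (n : ↥(unitaryGroupOfForm σ J)) * (weylLongU σ hJ)⁻¹))⁻¹) u)) =
      fun n : ↥(unipotentU σ J) => B u' (ρ (x * (weylLongU σ hJ * (n : ↥(unitaryGroupOfForm σ J)) * (weylLongU σ hJ)⁻¹) * t *
        (weylLongU σ hJ * (n : ↥(unitaryGroupOfForm σ J)) * (weylLongU σ hJ)⁻¹)⁻¹ * x⁻¹) u) := by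
    funext n; congr 2; group
  rw [heq]; exact h

/-- **(Φ_C, continuity)** the slice `x ↦ B u' (ρ(x t x⁻¹) u)` is continuous for a smooth `ρ` (locally constant coefficient ★
`Representation.IsSmooth.isLocallyConstant_apply`). [cite: Casselman1995, Prop. 1.4.4] -/
theorem continuous_coeff_conj (σ : K →+* K) {J : Matrix (Fin 2) (Fin 2) K}
    {V : Type*} [AddCommGroup V] [Module ℂ V] (ρ : Representation ℂ ↥(unitaryGroupOfForm σ J) V) (hsm : ρ.IsSmooth)
    (B : V →ₗ⋆[ℂ] V →ₗ[ℂ] ℂ) (t : ↥(unitaryGroupOfForm σ J)) (u u' : V) :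
    Continuous fun x : ↥(unitaryGroupOfForm σ J) => B u' (ρ (x * t * x⁻¹) u) :=
  (((Representation.IsSmooth.isLocallyConstant_apply ρ hsm u).comp fun w : V => B u' w).continuous).comp
    ((continuous_id.mul continuous_const).mul continuous_inv)

omit [ValuativeRel K] [TopologicalSpace K] [IsNonarchimedeanLocalField K] in
/-- **(Φ_C (i), right-`T`-invariance)** `f_t(x z) = f_t(x)` for `z ∈ T` and `t = diag d` REGULAR (`Z(t) = T`, ★ `mem_torusU_iff_mem_centralizer_of_isUnit_sub`).
[cite: HarishChandra1970, Part VII §2 p. 70 (i)] [cite: Rogawski1990, §3.6 p. 31] -/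
theorem coeff_conj_mul_eq_of_mem_torusU (σ : K →+* K) {J : Matrix (Fin 2) (Fin 2) K}
    {V : Type*} [AddCommGroup V] [Module ℂ V] (ρ : Representation ℂ ↥(unitaryGroupOfForm σ J) V)
    (B : V →ₗ⋆[ℂ] V →ₗ[ℂ] ℂ) (t : ↥(unitaryGroupOfForm σ J)) {d : Fin 2 → Kˣ} (hd : glDiagonal 2 K d = (t : GL (Fin 2) K))
    (hreg : IsRegularElt (t : GL (Fin 2) K)) (u u' : V) (x : ↥(unitaryGroupOfForm σ J)) {z : ↥(unitaryGroupOfForm σ J)} (hz : z ∈ torusU σ J) :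
    B u' (ρ (x * z * t * (x * z)⁻¹) u) = B u' (ρ (x * t * x⁻¹) u) := by
  have hreg' : IsRegularElt (glDiagonal 2 K d) := by rw [hd]; exact hreg
  have hzc : z ∈ Subgroup.centralizer ({t} : Set ↥(unitaryGroupOfForm σ J)) :=
    (mem_torusU_iff_mem_centralizer_of_isUnit_sub hd
      (fun i j hij => F0P3cStCharTSWeylHypFibre.isUnit_sub_of_isRegularElt_glDiagonal hreg' hij) z).1 hz
  exact apply_mul_conj_eq_of_commute (fun g => B u' (ρ g u)) t x z (Subgroup.mem_centralizer_singleton_iff.1 hzc)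

end Model

end Summit.HodgeConjecture.HodgeConjecture.Cruxes.H413.K2E3SupercuspOrbitalSliceCuspidalModelTwo

end
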